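/-
PORT (pub-hodgecm2, COR-CM cell) of the stage-1 package file `HodgeCMPerL/HodgeCM/StubTree/Qw8FaceBridge.lean`
(pub-hodgecm HOME/lean, bytes of record md5 a45208e999b1, 285 lines). Declarations VERBATIM; edits: imports rewritten to tree
modules, namespace token `HodgeCM` ↦ `Summit.HodgeConjecture.CorCM`, package `conjRingHomK` ↦ tree `Literature.NumberTheory.Automorphic.cmConjRingHom`
(definitionally equal bodies), linter fixes. Generator: pub-hodgecm2-p1 `work/port/build_kit.py`.
Filing delta (pub-hodgecm2-b07, lane variant): the generic helper `Universe.finrank_baseChange_eq` (a verbatim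
statement twin of the tree's `Model.finrank_baseChange_eq'`, `CorCM/WeilLineRank.lean`) is not re-declared; its
5-line proof is inlined into `qw8WeilGenAlg_holds`. Every other declaration is byte-identical to the kit of record.
-/
import Summits.HodgeConjecture.CorCM.StubTree.Qw8
import Summits.HodgeConjecture.CorCM.Proofs.Prop22.Eigen

/-!
# `Qw8Sufficiency`, v2: the ā-bridge `Qw8FaceBridge` split and DISCHARGED from the model axioms

`Summit.HodgeConjecture.CorCM/StubTree/Qw8.lean` (v1) splits the monolithic hypothesis `Summit.HodgeConjecture.CorCM.Universe.Qw8Sufficiency`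
([QW8] Thm 2.5 = `t:suff`, tex ll.245–262 of `inputs/2001/…y3__paper-v1-892bb948.tex` @ a463a4c8cc18) into
`Qw8Conj` (discharged there), `Qw8ExtProd`, `Qw8DualPushPull`, `Qw8Milne` and the §3 ā-bridge
`Qw8FaceBridge` ([QW8] Lemma 2.9 + Remark 2.6(a): an algebraic Weil face line `W_F(P_f) ⊆ Alg²(P_f)`
yields, for every `σ₀ : F → ℂ`, a NONZERO ALGEBRAIC weight vector of weight `(i ↦ {σ₀})` on
`P_f = ∏_{i<4} A_{(F, ψ_i Φ₀)}`, i.e. one with Lefschetz character `a_{F,(ψ_iΦ₀)_i}(J_{σ₀})`).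

This file splits the bridge into its two halves over the explicit Weil generators
`U.weilGen F Φ y = pr₀^*y₀ ∪ pr₁^*y₁ ∪ pr₂^*y₂ ∪ pr₃^*y₃` (`Summit.HodgeConjecture.CorCM/Proofs/Prop22/Basic.lean`) and proves
BOTH from `U.ModelAxioms`:

* `Qw8WeilGenWeight` — Weil generators built from `σ₀`-eigenvectors are weight vectors of weight
  `(i ↦ {σ₀})` (`qw8WeilGenWeight_holds`: M1 `pull_id`, M2 `pull_comp`, M3 `pull_cup`, definition of
  `eigenLine`; the bookkeeping is `pr_j^*` of the left-nested `cmProd F Φ = prodFin 3 _` versus `pr4` on the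
  definitionally equal `prod4 F Φ`, `pull_prj3_eq_pull_pr4`);
* `Qw8WeilGenAlg` — if `W_F(P_f) ⊆ Alg²` then for every `σ₀` some `σ₀`-generator is nonzero and lies in
  `Alg² ⊗ ℂ` (`qw8WeilGenAlg_holds`: linear algebra over M12 `Fact_eigenLine` and M15 `Fact_weilLine_rank` —
  all `σ`-generators are proportional (`weilGen_smul`), `span_ℂ(gens) ⊇ W_F ⊗ ℂ` has dimension `[F:ℚ] =
  #Hom(F,ℂ)` (flatness of `ℂ/ℚ`), hence no `σ`-generator on nonzero eigenvectors vanishes and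
  `span_ℂ(gens) = W_F ⊗ ℂ ⊆ Alg² ⊗ ℂ`).

Consequently `qw8FaceBridge_holds (M) : U.Qw8FaceBridge` and the net reduction
`qw8Sufficiency_of_modelAxioms (M) : U.Qw8ExtProd → U.Qw8DualPushPull → U.Qw8Milne → U.Qw8Sufficiency`:
in the model, `Qw8Sufficiency` needs exactly [QW8] Thm 2.5 steps (ii) exterior products, (iii)+(v) Poincaré
duality / push–pull, and (iv) = Milne 1999 (the only print input) — see the docstrings in `StubTree/Qw8.lean`
for the obstruction and the closing published input of each.

[QW8] is an internal, unrefereed 2001-programme preprint ("Lefschetz characters of CM abelian varieties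
and the Hodge conjecture for products of quartic Weil fourfolds", v1); only step (iv) is a print theorem
(Milne, Compositio Math. 117 (1999), via Deligne LNM 900 and André 1992).  Speedrun expansion seat
`pub-hodgecm-qw8`, 2026-08-18; provenance and verbatim source: `pub-hodgecm-qw8/QW8-SOURCE.md`.
-/

noncomputable section

open scoped TensorProduct

namespace Summit.HodgeConjecture.CorCM

open Literature.AlgebraicGeometry.Motives (CMType)
open Literature.AlgebraicGeometry.Motives.HodgeStructure (ofRat ofRat_apply)

namespace Universe

section Statements

variable (U : Universe)

/-! ### The ā-bridge split into its two halves (over the Weil generators `U.weilGen` of Proofs.Prop22.Basic;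
recall `U.cmProd F Φ = U.prod4 F Φ` definitionally for `Φ : Fin 4 → CMType F`) -/

/-- **Bridge half (a): Weil generators are weight vectors.**  For `y_i ∈ H¹(A_{(F,Φ_i)}, ℂ)_{σ₀}` the
class `pr₀^*y₀ ∪ pr₁^*y₁ ∪ pr₂^*y₂ ∪ pr₃^*y₃ ∈ H⁴(∏_i A_{Φ_i}, ℂ)` has weight `(i ↦ {σ₀})`: a factor-wise
CM action by `a` on the `j`-th factor multiplies it by `σ₀(a)`.  DISCHARGED from the model axioms
(`qw8WeilGenWeight_holds` below: M1 `pull_id`, M2 `pull_comp`, M3 `pull_cup` and the definition of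
`eigenLine`; the only work is `pr_j^*` of the left-nested `prodFin 3` versus `pr4`).  [QW8] §2.2
(`e_I` has weight `∏ σ_j`); Deligne LNM 900 §4. -/
def Qw8WeilGenWeight : Prop :=
  ∀ (F : CMField) (Φ : Fin 4 → CMType F) (σ₀ : (F : Type) →+* ℂ)
    (y : (i : Fin 4) → U.CohC (U.cmAV F (Φ i)) 1), (∀ i, y i ∈ U.eigenLine F (Φ i) σ₀) →
    U.IsWeightVector F Φ (fun _ => {σ₀}) (2 * 2) (U.weilGen F Φ y)

/-- **Bridge half (b): an algebraic face line has, for every `σ₀`, a NONZERO ALGEBRAIC `σ₀`-Weil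
generator.**  [QW8] Lemma 2.9 (`W_{K′}(Y) ⊗ ℚ̄ = ⊕_τ ℚ̄ e_{J_τ}`) + Remark 2.6(a); Deligne LNM 900 (4.4);
Moonen–Zarhin, Duke Math. J. 77 (1995) §2.  In the universe this is LINEAR ALGEBRA over two model facts:
M12 `Fact_eigenLine` (each eigenline is a line, so all `σ`-generators are proportional, `weilGen_smul`) and
M15 `Fact_weilLine_rank` (`dim_ℚ W_F(P) = [F:ℚ] = #Hom(F,ℂ)`): `span_ℂ(gens) ⊇ W_F(P) ⊗ ℂ` has dimension
`≥ [F:ℚ]` and is spanned by one generator per `σ`, so every `σ`-generator built from nonzero eigenvectors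
is nonzero and `span_ℂ(gens) = W_F(P) ⊗ ℂ ⊆ Alg² ⊗ ℂ` when `W_F(P) ⊆ Alg²`.  DISCHARGED
below (`qw8WeilGenAlg_holds`, from M12 and M15 only; multilinearity of `weilGen` is free). -/
def Qw8WeilGenAlg : Prop :=
  ∀ (F : CMField), IsGalois ℚ F → 6 ≤ Module.finrank ℚ F → ∀ (f : Face F), U.WeilFaceAlgebraic F f →
    ∀ (σ₀ : (F : Type) →+* ℂ), ∃ y : (i : Fin 4) → U.CohC (U.cmAV F (f.corner i)) 1,
      (∀ i, y i ∈ U.eigenLine F (f.corner i) σ₀) ∧ U.weilGen F f.corner y ≠ 0 ∧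
        U.weilGen F f.corner y ∈ U.algC (U.prod4 F f.corner) 2

/-- The bridge from its two halves. -/
theorem qw8FaceBridge_of_split (ha : U.Qw8WeilGenWeight) (hb : U.Qw8WeilGenAlg) : U.Qw8FaceBridge := by
  intro F hGal h6 f hf σ₀
  obtain ⟨y, hy, h0, halg⟩ := hb F hGal h6 f hf σ₀
  exact ⟨U.weilGen F f.corner y, h0, ha F f.corner σ₀ y hy, halg⟩

end Statements

variable {U : Universe}

/-! ### The projections of `prodFin 3` versus `pr4` -/

/-- `pr_j^*` of the left-nested fourfold product `cmProd F Φ = prodFin 3 _` agrees with `pr4_j^*` on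
`prod4 F Φ` (the two varieties are definitionally equal; the projections are the same morphism for
`j = 1, 2, 3` and differ by a composition with `id` for `j = 0`, removed by M1/M2). -/
theorem pull_prj3_eq_pull_pr4 (M : U.ModelAxioms) (F : CMField) (Φ : Fin 4 → CMType F) (k : ℕ) (i : Fin 4) :
    U.pull (U.prj 3 (fun i => U.cmAV F (Φ i)) i) k = U.pull (U.pr4 F Φ i) k := by
  match i with
  | 0 =>
    show U.pull (U.comp (U.fst _ _) (U.comp (U.fst _ _) (U.comp (U.fst _ _) (U.idMor _)))) k =
      U.pull (U.comp (U.fst _ _) (U.comp (U.fst _ _) (U.fst _ _))) k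
    rw [M.pull_comp, M.pull_comp, M.pull_comp, M.pull_comp, M.pull_comp, M.pull_id, LinearMap.comp_id]
  | 1 => rfl
  | 2 => rfl
  | 3 => rfl

/-! ### Half (a): Weil generators are weight vectors -/

/-- A morphism of `prod4 F Φ` acting on `H¹` as `ι(a)` on the `j`-th factor and as the identity on the
others multiplies every `σ₀`-Weil generator by `σ₀(a)` (all objects over the reducible `prod4`). -/
theorem pullC_weilGen_of_factorAct (M : U.ModelAxioms) {F : CMField} {Φ : Fin 4 → CMType F}
    {σ₀ : (F : Type) →+* ℂ} {y : (i : Fin 4) → U.CohC (U.cmAV F (Φ i)) 1}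
    (hy : ∀ i, y i ∈ U.eigenLine F (Φ i) σ₀) (j : Fin 4) (a : F)
    (Mo : U.Mor (U.prod4 F Φ) (U.prod4 F Φ))
    (h1 : U.pull Mo 1 ∘ₗ U.pull (U.pr4 F Φ j) 1 =
      U.pull (U.pr4 F Φ j) 1 ∘ₗ ((U.cmAct F (Φ j)).ι a : _ →ₗ[ℚ] _))
    (h2 : ∀ i, i ≠ j → U.pull Mo 1 ∘ₗ U.pull (U.pr4 F Φ i) 1 = U.pull (U.pr4 F Φ i) 1) :
    U.pullC Mo 4 (U.weilGen F Φ y) = σ₀ a • U.weilGen F Φ y := by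
  -- the scalar by which `Mo^*` acts on the `i`-th slot
  let c : Fin 4 → ℂ := fun i => if i = j then σ₀ a else 1
  have key : ∀ i, U.pullC Mo 1 (U.pullC (U.pr4 F Φ i) 1 (y i)) = U.pullC (U.pr4 F Φ i) 1 (c i • y i) := by
    intro i
    by_cases hij : i = j
    · subst hij
      have e := congrArg (LinearMap.baseChange ℂ) h1
      rw [LinearMap.baseChange_comp, LinearMap.baseChange_comp] at e
      have e' := LinearMap.congr_fun e (y i)
      simp only [LinearMap.comp_apply] at e'
      simp only [c, if_pos rfl]
      rw [← (mem_eigenLine_iff.mp (hy i)) a]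
      exact e'
    · simp only [c, if_neg hij, one_smul]
      exact pullC_pullC_of_comp_eq (h2 i hij) (y i)
  have hgen : U.pullC Mo 4 (U.weilGen F Φ y) = U.weilGen F Φ (fun i => c i • y i) := by
    rw [Universe.weilGen, Universe.weilGen, pullC_quadC M.pull_cup, key 0, key 1, key 2, key 3]
  rw [hgen, weilGen_smul]
  congr 1
  simp [c]

/-- **`Qw8WeilGenWeight` holds under the model axioms.** -/
theorem qw8WeilGenWeight_holds (M : U.ModelAxioms) : U.Qw8WeilGenWeight := by
  intro F Φ σ₀ y hy j a Mo hMo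
  obtain ⟨h1, h2⟩ := hMo
  rw [Finset.prod_singleton]
  refine pullC_weilGen_of_factorAct M hy j a Mo ?_ ?_
  · rw [← pull_prj3_eq_pull_pr4 M F Φ 1 j]
    exact h1
  · intro i hi
    rw [← pull_prj3_eq_pull_pr4 M F Φ 1 i]
    exact h2 i hi

/-! ### Half (b): nonzero algebraic generators, from M12 + M15 -/

/-- In a line (`finrank = 1`) every vector is a multiple of a given nonzero one (subtype-free form). -/
theorem exists_smul_eq_of_finrank_eq_one {V : Type*} [AddCommGroup V] [Module ℂ V] (L : Submodule ℂ V)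
    (hL : Module.finrank ℂ L = 1) {v : V} (hv : v ∈ L) (hv0 : v ≠ 0) {w : V} (hw : w ∈ L) :
    ∃ t : ℂ, t • v = w := by
  have hv0' : (⟨v, hv⟩ : L) ≠ 0 := fun h => hv0 (congrArg Subtype.val h)
  obtain ⟨t, ht⟩ := (finrank_eq_one_iff_of_nonzero' (⟨v, hv⟩ : L) hv0').mp hL ⟨w, hw⟩
  exact ⟨t, congrArg Subtype.val ht⟩

/-- An eigenline contains a nonzero vector (M12). -/
theorem exists_ne_zero_mem_eigenLine (M : U.ModelAxioms) (K : CMField) (Φ : CMType K) (σ : (K : Type) →+* ℂ) :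
    ∃ x ∈ U.eigenLine K Φ σ, x ≠ 0 := by
  by_contra h
  have hbot : U.eigenLine K Φ σ = ⊥ := by
    rw [Submodule.eq_bot_iff]
    intro x hx
    by_contra hne
    exact h ⟨x, hx, hne⟩
  have h1 := M.eigenLine K Φ σ
  rw [hbot, finrank_bot] at h1
  exact zero_ne_one h1

/-- **`Qw8WeilGenAlg` holds under the model axioms** (M12 `eigenLine`,
M15 `weilLine_rank`; the hypotheses `IsGalois`/`6 ≤ [F:ℚ]` are not used). -/
theorem qw8WeilGenAlg_holds (M : U.ModelAxioms) : U.Qw8WeilGenAlg := by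
  intro F _ _ f hf σ₀
  -- (1) nonzero eigenvectors `x i σ ∈ H¹(A_{Φ_i}, ℂ)_σ`
  have hx := fun (i : Fin 4) (σ : (F : Type) →+* ℂ) => exists_ne_zero_mem_eigenLine M F (f.corner i) σ
  choose x hxmem hx0 using hx
  -- (2) the candidate generators `e σ`
  let e : ((F : Type) →+* ℂ) → U.CohC (U.prod4 F f.corner) 4 :=
    fun σ => U.weilGen F f.corner (fun i => x i σ)
  -- every generator is a multiple of some `e σ`
  have hgen : ∀ g ∈ U.weilGenerators F f.corner, ∃ (σ : (F : Type) →+* ℂ) (t : ℂ), g = t • e σ := by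
    rintro g ⟨σ, y, hy, rfl⟩
    have ht : ∀ i, ∃ t : ℂ, t • x i σ = y i := fun i =>
      exists_smul_eq_of_finrank_eq_one _ (M.eigenLine F (f.corner i) σ) (hxmem i σ) (hx0 i σ) (hy i)
    choose t ht using ht
    refine ⟨σ, ∏ i, t i, ?_⟩
    show U.weilGen F f.corner y = (∏ i, t i) • U.weilGen F f.corner (fun i => x i σ)
    rw [← weilGen_smul]
    congr 1
    funext i
    exact (ht i).symm
  -- (3) `G := span gens ≤ span (range e)`
  have hG_le : Submodule.span ℂ (U.weilGenerators F f.corner) ≤ Submodule.span ℂ (Set.range e) := by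
    rw [Submodule.span_le]
    intro g hg
    obtain ⟨σ, t, rfl⟩ := hgen g hg
    exact Submodule.smul_mem _ t (Submodule.subset_span ⟨σ, rfl⟩)
  -- (4) `W_F ⊗ ℂ ≤ G`, of dimension `[F:ℚ]`
  have hWG : (U.weilLine F f.corner).baseChange ℂ ≤ Submodule.span ℂ (U.weilGenerators F f.corner) := by
    rw [Submodule.baseChange_eq_span, Submodule.span_le]
    rintro _ ⟨w, hw, rfl⟩
    exact hw
  have hWrank : Module.finrank ℂ ((U.weilLine F f.corner).baseChange ℂ) = Module.finrank ℚ F := by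
    -- `dim_ℂ (W_F ⊗ ℂ) = dim_ℚ W_F` (flatness of `ℂ/ℚ`), then M15
    have hinj : Function.Injective (((U.weilLine F f.corner).subtype).baseChange ℂ) := by
      have h := Module.Flat.lTensor_preserves_injective_linearMap (M := ℂ) (U.weilLine F f.corner).subtype
        (U.weilLine F f.corner).injective_subtype
      intro a b hab
      exact h (by simpa [LinearMap.baseChange_eq_ltensor] using hab)
    rw [← M.weilLine_rank F f.corner, Submodule.baseChange, LinearMap.finrank_range_of_inj hinj,
      Module.finrank_baseChange]
  have hcard : Fintype.card ((F : Type) →+* ℂ) = Module.finrank ℚ F := NumberField.Embeddings.card F ℂ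
  -- (5) `e σ₀ ≠ 0`: otherwise `G` is spanned by `[F:ℚ] - 1` vectors but contains `W_F ⊗ ℂ`
  have hne : e σ₀ ≠ 0 := by
    intro h0
    classical
    let s : Finset (U.CohC (U.prod4 F f.corner) 4) := (Finset.univ.erase σ₀).image e
    have hrange : Set.range e ⊆ insert 0 (s : Set _) := by
      rintro _ ⟨σ, rfl⟩
      by_cases hσ : σ = σ₀
      · subst hσ
        rw [h0]
        exact Set.mem_insert _ _
      · refine Set.mem_insert_of_mem _ ?_
        rw [Finset.mem_coe]
        exact Finset.mem_image_of_mem e (Finset.mem_erase.mpr ⟨hσ, Finset.mem_univ σ⟩)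
    have hspan : Submodule.span ℂ (Set.range e) ≤ Submodule.span ℂ (s : Set _) :=
      (Submodule.span_mono hrange).trans (Submodule.span_insert_zero).le
    have h1 : Module.finrank ℂ (Submodule.span ℂ (s : Set (U.CohC (U.prod4 F f.corner) 4))) ≤ s.card :=
      finrank_span_finset_le_card s
    have h2 : s.card ≤ Fintype.card ((F : Type) →+* ℂ) - 1 := by
      calc s.card ≤ (Finset.univ.erase σ₀).card := Finset.card_image_le
        _ = Fintype.card ((F : Type) →+* ℂ) - 1 := by rw [Finset.card_erase_of_mem (Finset.mem_univ _), Finset.card_univ]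
    have h3 : Module.finrank ℚ F ≤
        Module.finrank ℂ (Submodule.span ℂ (s : Set (U.CohC (U.prod4 F f.corner) 4))) := by
      rw [← hWrank]
      exact Submodule.finrank_mono ((hWG.trans hG_le).trans hspan)
    have h4 : 0 < Module.finrank ℚ F := Module.finrank_pos
    omega
  -- (6) `G = W_F ⊗ ℂ ⊆ Alg² ⊗ ℂ`
  have hGeq : (U.weilLine F f.corner).baseChange ℂ = Submodule.span ℂ (U.weilGenerators F f.corner) := by
    apply Submodule.eq_of_le_of_finrank_le hWG
    rw [hWrank]
    calc Module.finrank ℂ (Submodule.span ℂ (U.weilGenerators F f.corner))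
        ≤ Module.finrank ℂ (Submodule.span ℂ (Set.range e)) := Submodule.finrank_mono hG_le
      _ ≤ Fintype.card ((F : Type) →+* ℂ) := finrank_range_le_card e
      _ = Module.finrank ℚ F := hcard
  refine ⟨fun i => x i σ₀, fun i => hxmem i σ₀, hne, ?_⟩
  have hmem : e σ₀ ∈ Submodule.span ℂ (U.weilGenerators F f.corner) :=
    Submodule.subset_span (weilGen_mem (fun i => hxmem i σ₀))
  rw [← hGeq] at hmem
  exact Submodule.baseChange_mono ℂ hf hmem

/-- **The ā-bridge holds under the model axioms.** -/
theorem qw8FaceBridge_holds (M : U.ModelAxioms) : U.Qw8FaceBridge :=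
  U.qw8FaceBridge_of_split (qw8WeilGenWeight_holds M) (qw8WeilGenAlg_holds M)

/-- **Net reduction (v2).**  In the model, `Qw8Sufficiency` follows from the three remaining [QW8]
Thm 2.5 steps: (ii) exterior products `Qw8ExtProd`, (iii)+(v) duality / push–pull `Qw8DualPushPull`,
(iv) Milne 1999 `Qw8Milne`. -/
theorem qw8Sufficiency_of_modelAxioms (M : U.ModelAxioms) (hE : U.Qw8ExtProd)
    (hD : U.Qw8DualPushPull) (hM : U.Qw8Milne) : U.Qw8Sufficiency :=
  U.qw8Sufficiency_of_steps' hE hD hM (qw8FaceBridge_holds M)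

end Universe

end Summit.HodgeConjecture.CorCM

end
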